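import Summits.CriticalPhenomena.PercolationContinuityZ3.Theorems.PercNearOneGluingNoHeavyQuantTreeBuiltAD3Cells
import HarnessLib

/-!
# QUANT lane R8, T-DEC, ROUTE 2 tools: every ADMISSIBLE three-atom law is AD3⁺-decomposable (non-HD: itself; HD: two HEAVY pairs), and the
# gated small laws written explicitly (`gate{lo,hi;γ} q₀` = a zero pair / a triple through `0`; `gate` of a triple through `0` = a triple through `0`)

builds on p205010 (kernel theorem, internal audit signed; external expert review pending)

Support file (`--supports stmt-CriticalPhenomena-4575`), QUANT lane, TYPER seat prim-quant-stmt (gen 31), rung R8 of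
`run/shared/lean/prim/quant/LADDER.md`; tools for the elementary sub-cases of the Route-2 cell `LawDec.AD3GateCell` (`…QuantTreeBuiltAD3Cells`).
Theorems only, standard axioms, no sorries, no definitions.

* `LawDec.gate_TP_eq_TR` — `gate{lo, hi; γ} q₀ = {0: 1−q₀, lo: q₀(1−γ), hi: q₀γ}` as a `TR` law; `LawDec.gate_TP_zero` — `gate{0, hi; γ} q₀ = {0, hi; q₀γ}`;
  `LawDec.gate_TP_point` — `gate{s, s; γ} q₀ = {0, s; q₀}`; `LawDec.gate_TR_zero` — `gate{0, s₂, s₃; p} q₀ = {0, s₂, s₃; (1−q₀+q₀p₁, q₀p₂, q₀p₃)}`.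
* `LawDec.ad3Decomp_of_zeroOrBig` — a law with no charged atom in `(0, T)` is AD3⁺ (point mass at `T` + heavy zero pairs, Lemma P).
* **`LawDec.ad3Decomp_of_admissibleTriple`** — a three-atom law `p₁δ_{s₁}+p₂δ_{s₂}+p₃δ_{s₃}` (`s₁<s₂<s₃ ≤ M`, `pᵢ > 0`, mean `T`) whose `q`-gated
  version is DEC at every layer `j′ < M` at floor `y ≤ q` admits an AD3⁺ decomposition at `(y, q, T, M)`: if it is not heavy-decomposable it is an
  L3 component itself; otherwise typer g30's identities `triple_eq_twoPairs_low/high` write it as a mixture of its two mean-`T` pairs, BOTH HEAVY —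
  for `s₂ ≤ T`: `γ₂₃ = (T−s₂)/(s₃−s₂) ≥ y/q` is the HD inequality and `γ₁₃ ≥ γ₂₃` since `(s₂−s₁)(s₃−T) ≥ 0` (with `y ≤ q`); for `T < s₂`:
  `γ₁₃ ≥ y/q` is the HD inequality and `γ₁₂ ≥ γ₁₃`.
HONEST STATUS: tools only; `AD3GateCell`, `AD3ProdCell`, `TreeBuiltAD3`, `FarTreeRow` OPEN; RATE class log\* / honest sentence unchanged.

[this work]; identities `triple_eq_twoPairs_low/high`: prim-quant-stmt g30 (this lane).  The gluing rows served [cite: KozmaNitzan2024, Conjecture 3 (p. 15)];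
product measure [cite: Grimmett1999, §1.3 p. 10].
-/

noncomputable section

namespace Summit.CriticalPhenomena.PercolationContinuityZ3.Theorems

namespace Quant

open Finset

/-- two-point law notation `TP[lo, hi, g, h] = g·[h = hi] + (1 − g)·[h = lo]` (as in the lane's other files). -/
local notation3 "TP[" lo ", " hi ", " g ", " h "]" =>
  (g : ℝ) * (if (h : ℕ) = (hi : ℕ) then (1 : ℝ) else 0) + (1 - (g : ℝ)) * (if (h : ℕ) = (lo : ℕ) then (1 : ℝ) else 0)

/-- three-atom law notation `TR[s₁, s₂, s₃, p₁, p₂, p₃, h] = p₁·[h = s₁] + p₂·[h = s₂] + p₃·[h = s₃]`. -/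
local notation3 "TR[" s₁ ", " s₂ ", " s₃ ", " p₁ ", " p₂ ", " p₃ ", " h "]" =>
  (p₁ : ℝ) * (if (h : ℕ) = (s₁ : ℕ) then (1 : ℝ) else 0) + (p₂ : ℝ) * (if (h : ℕ) = (s₂ : ℕ) then (1 : ℝ) else 0)
    + (p₃ : ℝ) * (if (h : ℕ) = (s₃ : ℕ) then (1 : ℝ) else 0)

namespace LawDec

/-! ### Gated small laws, explicitly -/

/-- `gate{lo, hi; γ} q₀ = (1−q₀)δ₀ + q₀(1−γ)δ_lo + q₀γ δ_hi`. [this work] -/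
theorem gate_TP_eq_TR (lo hi : ℕ) (γ q₀ : ℝ) :
    gate (fun h => TP[lo, hi, γ, h]) q₀ = fun h => TR[0, lo, hi, 1 - q₀, q₀ * (1 - γ), q₀ * γ, h] := by
  funext h; simp only [gate]; split_ifs <;> ring

/-- `gate{0, hi; γ} q₀ = {0, hi; q₀γ}`. [this work] -/
theorem gate_TP_zero (hi : ℕ) (γ q₀ : ℝ) : gate (fun h => TP[0, hi, γ, h]) q₀ = fun h => TP[0, hi, q₀ * γ, h] := by
  funext h; simp only [gate]; split_ifs <;> ring

/-- `gate δ_s q₀ = {0, s; q₀}` (the point mass written as the degenerate pair `{s, s; γ}`). [this work] -/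
theorem gate_TP_point (s : ℕ) (γ q₀ : ℝ) : gate (fun h => TP[s, s, γ, h]) q₀ = fun h => TP[0, s, q₀, h] := by
  funext h; simp only [gate]; split_ifs <;> ring

/-- `gate{0, s₂, s₃; p₁, p₂, p₃} q₀ = {0, s₂, s₃; 1 − q₀ + q₀p₁, q₀p₂, q₀p₃}`. [this work] -/
theorem gate_TR_zero (s₂ s₃ : ℕ) (p₁ p₂ p₃ q₀ : ℝ) :
    gate (fun h => TR[0, s₂, s₃, p₁, p₂, p₃, h]) q₀ = fun h => TR[0, s₂, s₃, 1 - q₀ + q₀ * p₁, q₀ * p₂, q₀ * p₃, h] := by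
  funext h; simp only [gate]; split_ifs <;> ring

/-- `{lo, hi; 1} = {hi, hi; 1}` (a degenerate gate is a point mass). [folklore] -/
theorem TP_gate_one (lo hi : ℕ) : (fun h : ℕ => TP[lo, hi, (1 : ℝ), h]) = fun h => TP[hi, hi, (1 : ℝ), h] := by
  funext h; ring

/-- `{lo, hi; 0} = {lo, lo; 0}` (a degenerate gate is a point mass). [folklore] -/
theorem TP_gate_zero (lo hi : ℕ) : (fun h : ℕ => TP[lo, hi, (0 : ℝ), h]) = fun h => TP[lo, lo, (0 : ℝ), h] := by
  funext h; ring

/-! ### An admissible triple is AD3⁺-decomposable -/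

/-- **EVERY ADMISSIBLE THREE-ATOM LAW IS AD3⁺-DECOMPOSABLE.**  `s₁ < s₂ < s₃ ≤ M`, masses `pᵢ > 0` summing to `1`, mean `T`, floor `0 < y ≤ q`,
gated version `gate_q` DEC at every layer `j′ < M` at floor `y`: then `AD3Decomp y q T M` holds for the triple — itself if it is not
heavy-decomposable (an L3 component), else the two heavy pairs of its unique mean-`T` pair decomposition (`triple_eq_twoPairs_low/high`). [this work] -/
theorem ad3Decomp_of_admissibleTriple (y q T : ℝ) (M s₁ s₂ s₃ : ℕ) (p₁ p₂ p₃ : ℝ) (hy0 : 0 < y) (hyq : y ≤ q)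
    (h12 : s₁ < s₂) (h23 : s₂ < s₃) (h3 : s₃ ≤ M) (hp₁ : 0 < p₁) (hp₂ : 0 < p₂) (hp₃ : 0 < p₃) (hp : p₁ + p₂ + p₃ = 1)
    (hT : p₁ * (s₁ : ℝ) + p₂ * (s₂ : ℝ) + p₃ * (s₃ : ℝ) = T)
    (hD : ∀ j', j' < M → DECAt y j' M (gate (fun h => TR[s₁, s₂, s₃, p₁, p₂, p₃, h]) q)) :
    AD3Decomp y q T M (fun h => TR[s₁, s₂, s₃, p₁, p₂, p₃, h]) := by
  have hq0 : 0 < q := lt_of_lt_of_le hy0 hyq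
  have hs12 : (s₁ : ℝ) < s₂ := by exact_mod_cast h12
  have hs23 : (s₂ : ℝ) < s₃ := by exact_mod_cast h23
  have hs1T : (s₁ : ℝ) < T := by nlinarith
  have hTs3 : T < (s₃ : ℝ) := by nlinarith
  by_cases hHD : ((s₂ : ℝ) ≤ T ∧ q * (T - s₂) < y * ((s₃ : ℝ) - s₂) ∨ T < (s₂ : ℝ) ∧ q * (T - s₁) < y * ((s₃ : ℝ) - s₁))
  · exact ad3Decomp_of_component (Or.inr (Or.inr ⟨s₁, s₂, s₃, p₁, p₂, p₃, h12, h23, h3, hp₁, hp₂, hp₃, hp, hT, hHD, hD, rfl⟩))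
  · by_cases hs2 : (s₂ : ℝ) ≤ T
    · -- pairs `(s₁, s₃)` and `(s₂, s₃)`, both heavy
      have hh : y * ((s₃ : ℝ) - s₂) ≤ q * (T - s₂) := by
        by_contra hlt; exact hHD (Or.inl ⟨hs2, lt_of_not_ge hlt⟩)
      have d13 : (0 : ℝ) < (s₃ : ℝ) - s₁ := by linarith
      have d23 : (0 : ℝ) < (s₃ : ℝ) - s₂ := by linarith
      have d3T : (0 : ℝ) < (s₃ : ℝ) - T := by linarith
      refine (ad3Decomp_iff y q T M _).2 ⟨Bool, inferInstance,
        fun b => cond b (p₁ * ((s₃ : ℝ) - s₁) / ((s₃ : ℝ) - T)) (p₂ * ((s₃ : ℝ) - s₂) / ((s₃ : ℝ) - T)),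
        fun b => cond b (fun h => TP[s₁, s₃, (T - s₁) / ((s₃ : ℝ) - s₁), h]) (fun h => TP[s₂, s₃, (T - s₂) / ((s₃ : ℝ) - s₂), h]),
        ?_, ?_, ?_, ?_⟩
      · intro b; cases b <;> simp only [cond_true, cond_false] <;> positivity
      · simp only [Fintype.sum_bool, cond_true, cond_false]
        have e : p₁ * ((s₃ : ℝ) - s₁) + p₂ * ((s₃ : ℝ) - s₂) = (s₃ : ℝ) - T := by linear_combination (s₃ : ℝ) * hp - hT
        rw [← add_div, e, div_self (ne_of_gt d3T)]
      · intro h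
        simp only [Fintype.sum_bool, cond_true, cond_false]
        exact triple_eq_twoPairs_low p₁ p₂ p₃ T s₁ s₂ s₃ h12 h23 hp hT hTs3 h
      · intro b _
        cases b
        · -- `(s₂, s₃)`
          refine Or.inl ⟨s₂, s₃, (T - s₂) / ((s₃ : ℝ) - s₂), h23.le, h3, div_nonneg (by linarith) d23.le,
            (div_le_one d23).2 (by linarith), ?_, ?_, by simp only [cond_false]⟩
          · rw [mul_div_assoc', le_div_iff₀ d23]; linarith
          · have e : ((s₃ : ℝ) - s₂) * ((T - s₂) / ((s₃ : ℝ) - s₂)) = T - s₂ := by field_simp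
            linarith
        · -- `(s₁, s₃)`: `γ₁₃ ≥ γ₂₃ ≥ y/q`
          refine Or.inl ⟨s₁, s₃, (T - s₁) / ((s₃ : ℝ) - s₁), (h12.trans h23).le, h3, div_nonneg (by linarith) d13.le,
            (div_le_one d13).2 (by linarith), ?_, ?_, by simp only [cond_true]⟩
          · rw [mul_div_assoc', le_div_iff₀ d13]
            nlinarith
          · have e : ((s₃ : ℝ) - s₁) * ((T - s₁) / ((s₃ : ℝ) - s₁)) = T - s₁ := by field_simp
            linarith
    · -- `T < s₂`: pairs `(s₁, s₂)` and `(s₁, s₃)`, both heavy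
      rw [not_le] at hs2
      have hh : y * ((s₃ : ℝ) - s₁) ≤ q * (T - s₁) := by
        by_contra hlt; exact hHD (Or.inr ⟨hs2, lt_of_not_ge hlt⟩)
      have d12 : (0 : ℝ) < (s₂ : ℝ) - s₁ := by linarith
      have d13 : (0 : ℝ) < (s₃ : ℝ) - s₁ := by linarith
      have dT1 : (0 : ℝ) < T - s₁ := by linarith
      refine (ad3Decomp_iff y q T M _).2 ⟨Bool, inferInstance,
        fun b => cond b (p₂ * ((s₂ : ℝ) - s₁) / (T - s₁)) (p₃ * ((s₃ : ℝ) - s₁) / (T - s₁)),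
        fun b => cond b (fun h => TP[s₁, s₂, (T - s₁) / ((s₂ : ℝ) - s₁), h]) (fun h => TP[s₁, s₃, (T - s₁) / ((s₃ : ℝ) - s₁), h]),
        ?_, ?_, ?_, ?_⟩
      · intro b; cases b <;> simp only [cond_true, cond_false] <;> positivity
      · simp only [Fintype.sum_bool, cond_true, cond_false]
        have e : p₂ * ((s₂ : ℝ) - s₁) + p₃ * ((s₃ : ℝ) - s₁) = T - s₁ := by linear_combination hT - (s₁ : ℝ) * hp
        rw [← add_div, e, div_self (ne_of_gt dT1)]
      · intro h
        simp only [Fintype.sum_bool, cond_true, cond_false]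
        exact triple_eq_twoPairs_high p₁ p₂ p₃ T s₁ s₂ s₃ h12 h23 hp hT hs1T h
      · intro b _
        cases b
        · -- `(s₁, s₃)`
          refine Or.inl ⟨s₁, s₃, (T - s₁) / ((s₃ : ℝ) - s₁), (h12.trans h23).le, h3, div_nonneg dT1.le d13.le,
            (div_le_one d13).2 (by linarith), ?_, ?_, by simp only [cond_false]⟩
          · rw [mul_div_assoc', le_div_iff₀ d13]; linarith
          · have e : ((s₃ : ℝ) - s₁) * ((T - s₁) / ((s₃ : ℝ) - s₁)) = T - s₁ := by field_simp
            linarith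
        · -- `(s₁, s₂)`: `γ₁₂ ≥ γ₁₃`
          refine Or.inl ⟨s₁, s₂, (T - s₁) / ((s₂ : ℝ) - s₁), h12.le, by omega, div_nonneg dT1.le d12.le,
            (div_le_one d12).2 (by linarith), ?_, ?_, by simp only [cond_true]⟩
          · rw [mul_div_assoc', le_div_iff₀ d12]
            nlinarith
          · have e : ((s₂ : ℝ) - s₁) * ((T - s₁) / ((s₂ : ℝ) - s₁)) = T - s₁ := by field_simp
            linarith

/-! ### A law with no positive atom below its mean is AD3⁺ (heavy zero pairs) -/

/-- **ZERO-OR-BIG LAWS ARE AD3⁺-DECOMPOSABLE.**  A probability law `μ` on `{0..M}` of mean `T` with NO charged atom in `(0, T)`, at a floor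
`0 ≤ y ≤ q` with `y·M ≤ q·T`: Lemma P (`exists_twoPoint_decomposition_TA`) writes it as a mixture of the point mass at `T` and ZERO PAIRS
`{0, hi; T/hi}`, all heavy (`y·hi ≤ y·M ≤ q·T`).  (The sub-case "`q₀T ≤ s₁`" of the gate cell, and arm-2 g35's zero-or-big observation, in
decomposition form.) [this work] -/
theorem ad3Decomp_of_zeroOrBig (y q T : ℝ) (M : ℕ) (μ : ℕ → ℝ) (hy0 : 0 ≤ y) (hq0 : 0 < q) (hyq : y ≤ q)
    (hμ0 : ∀ h, 0 ≤ μ h) (hμM : ∀ h, M < h → μ h = 0) (hμ1 : ∑ h ∈ Finset.range (M + 1), μ h = 1)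
    (hmean : ∑ h ∈ Finset.range (M + 1), (h : ℝ) * μ h = T) (hta : y * (M : ℝ) ≤ q * T)
    (hbig : ∀ k : ℕ, 0 < k → (k : ℝ) < T → μ k = 0) : AD3Decomp y q T M μ := by
  have htop : ∀ h, 0 < μ h → y / q * (h : ℝ) ≤ ∑ k ∈ Finset.range (M + 1), (k : ℝ) * μ k := by
    intro h hh
    have hhM : h ≤ M := by
      by_contra hlt; rw [not_le] at hlt; exact absurd (hμM h hlt) (ne_of_gt hh)
    rw [hmean, div_mul_eq_mul_div, div_le_iff₀ hq0]
    have : y * (h : ℝ) ≤ y * (M : ℝ) := mul_le_mul_of_nonneg_left (by exact_mod_cast hhM) hy0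
    linarith [mul_comm T q]
  obtain ⟨lam, g, lo, hi, h0, h1, hg, hlohi, hhi, hμ, hgen⟩ := exists_twoPoint_decomposition_TA M M le_rfl μ hμ0 hμM hμ1 (y / q) htop
  refine (ad3Decomp_iff y q T M μ).2 ⟨Fin (M + 1) × Fin (M + 1), inferInstance, lam, fun r h => TP[lo r, hi r, g r, h], h0, h1, hμ,
    fun r hr => ?_⟩
  obtain ⟨hlo0, -, hmr, hgenu, -⟩ := hgen r hr
  rw [hmean] at hmr hgenu
  rcases (hlohi r).eq_or_lt with heq | hlt
  · -- point mass at `T`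
    refine Or.inl ⟨lo r, lo r, 1, le_rfl, heq ▸ hhi r, zero_le_one, le_rfl, by rw [mul_one]; exact hyq, ?_, ?_⟩
    · rw [← hmr, heq]; ring
    · funext h
      show TP[lo r, hi r, g r, h] = TP[lo r, lo r, (1 : ℝ), h]
      rw [← heq]; ring
  · -- genuine pair: `lo = 0` (no charged atom strictly between `0` and `T`), a heavy zero pair
    have hloT := (hgenu hlt).1
    have hlo : lo r = 0 := by
      by_contra hne
      exact absurd (hbig (lo r) (Nat.pos_of_ne_zero hne) hloT) (ne_of_gt hlo0)
    have hhi0 : (0 : ℝ) < hi r := by exact_mod_cast (lt_of_le_of_lt (Nat.zero_le _) hlt)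
    have hmr' : (hi r : ℝ) * g r = T := by rw [← hmr, hlo]; push_cast; ring
    refine Or.inl ⟨lo r, hi r, g r, (hlohi r), hhi r, (hg r).1, (hg r).2, ?_, hmr, rfl⟩
    -- heavy: `y·hi ≤ y·M ≤ q·T = q·hi·g`
    have h1 : y * (hi r : ℝ) ≤ q * T := by
      have : y * (hi r : ℝ) ≤ y * (M : ℝ) := mul_le_mul_of_nonneg_left (by exact_mod_cast hhi r) hy0
      linarith
    rw [← hmr'] at h1
    by_contra hlt'
    rw [not_le] at hlt'
    have : q * ((hi r : ℝ) * g r) < y * (hi r : ℝ) := by nlinarith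
    linarith

end LawDec

end Quant

end Summit.CriticalPhenomena.PercolationContinuityZ3.Theorems
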